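import Mathlib
import HarnessLib

/-!
# Deterministic-proposal Metropolis: volume-preserving involutions are exact (HMC skeleton, T-REX swap)

HONEST FRAMING: exact (Metropolis-corrected) sampling algorithms for lattice gauge theory;
figures of merit are autocorrelation/cost numbers at stated couplings and volumes; no
continuum-physics claim.

Venture `LatticeQCDFlow` (cell pub-lqcd), topic `Exactness`, FANOUT row 30 (lean-1); items L7
("HMC exactness skeleton") and E5 ("replica-exchange swap through a deterministic bijective
volume-preserving map — T-REX") of HOME/VENTURE-STATEMENT.md / HOME/THEORY-1.md §5.  NEW WORK
of the cell over Mathlib's Markov-kernel library; nothing here is cited as a fact.  Printed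
counterparts, named only: Duane–Kennedy–Pendleton–Roweth 1987 and Lüscher 2010 §6 (HMC is exact
because the leapfrog map composed with the momentum flip is a volume-preserving involution),
Tierney 1998 §2 (deterministic proposals), the T-REX swap move of arXiv:2404.11674 (replica
exchange through a flow with unit Jacobian).

## Content (reference measure `vol` on a measurable space `Ω`, "energy" `H : Ω → ℝ`)

* `involMH Φ hΦ H : Kernel Ω Ω` — from `x` propose the deterministic move `x ↦ Φ x`, accept with
  probability `min {1, e^{H x − H (Φ x)}}`, else stay;
* `involMH_isReversible` — if `Φ` is an INVOLUTION (`Φ ∘ Φ = id`) preserving `vol`, the kernel is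
  reversible (`Kernel.IsReversible`) with respect to `e^{−H} · vol`, and `involMH_invariant` —
  `e^{−H} vol` is invariant.  Mechanism: `e^{−H x} min{1, e^{H x − H Φx}} = min{e^{−H x}, e^{−H Φx}}`
  is `Φ`-invariant, and `vol`-preservation substitutes `x ↦ Φ x`.
  HMC is the instance `Ω` = phase space, `vol` = Liouville measure, `H` = Hamiltonian,
  `Φ = (momentum flip) ∘ (leapfrog trajectory)`: any reversible, volume-preserving integrator
  gives an EXACT algorithm whatever its accuracy (accuracy only drives the acceptance) — this is
  the skeleton; the integrator's two properties are its hypotheses.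
* `trexSwap f (x, y) = (f⁻¹ y, f x)` — the T-REX replica-exchange move through a measurable
  bijection `f`; `trexSwap_involutive`, `measurePreserving_trexSwap` (for `vol`-preserving `f`);
  `trex_isReversible` (E5): the swap, Metropolis-corrected with
  `min {1, exp (S₁ x + S₂ y − S₁ (f⁻¹ y) − S₂ (f x))}`, is reversible for
  `e^{−S₁(x) − S₂(y)} vol ⊗ vol` — exact for EVERY volume-preserving `f`, trained or not.

Not here: flows with non-trivial Jacobian inside the swap (compose with `FlowPushforward.lean`:
conjugate by the Jacobian density), ergodicity, and anything quantitative.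
-/

namespace Summit.Ventures.LatticeQCDFlow.Exactness

open MeasureTheory ProbabilityTheory
open scoped ENNReal

variable {Ω : Type*} [MeasurableSpace Ω]

/-! ## Acceptance for a deterministic proposal -/

/-- Metropolis acceptance probability `min {1, e^{H x − H (Φ x)}}` for the deterministic move
`x ↦ Φ x`. -/
noncomputable def involAccept (H : Ω → ℝ) (Φ : Ω → Ω) (x : Ω) : ℝ :=
  min 1 (Real.exp (H x - H (Φ x)))

/-- The acceptance probability as an `ℝ≥0∞`-valued density. -/
noncomputable def involAcceptE (H : Ω → ℝ) (Φ : Ω → Ω) (x : Ω) : ℝ≥0∞ :=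
  ENNReal.ofReal (involAccept H Φ x)

omit [MeasurableSpace Ω] in
/-- The acceptance density is at most one. -/
theorem involAcceptE_le_one (H : Ω → ℝ) (Φ : Ω → Ω) (x : Ω) : involAcceptE H Φ x ≤ 1 := by
  unfold involAcceptE involAccept
  rw [← ENNReal.ofReal_one]
  exact ENNReal.ofReal_le_ofReal (min_le_left _ _)

/-- Measurability of the acceptance density. -/
theorem measurable_involAcceptE {H : Ω → ℝ} {Φ : Ω → Ω} (hH : Measurable H) (hΦ : Measurable Φ) :
    Measurable (involAcceptE H Φ) := by
  unfold involAcceptE involAccept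
  exact (measurable_const.min (Real.measurable_exp.comp (hH.sub (hH.comp hΦ)))).ennreal_ofReal

omit [MeasurableSpace Ω] in
/-- **The detailed-balance identity of the integrand**:
`e^{−H x} · min{1, e^{H x − H Φx}} = min{e^{−H x}, e^{−H (Φ x)}}`. -/
theorem exp_neg_mul_involAccept (H : Ω → ℝ) (Φ : Ω → Ω) (x : Ω) :
    Real.exp (-H x) * involAccept H Φ x = min (Real.exp (-H x)) (Real.exp (-H (Φ x))) := by
  unfold involAccept
  rw [mul_min_of_nonneg _ _ (Real.exp_pos _).le, mul_one, ← Real.exp_add]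
  congr 2
  ring

omit [MeasurableSpace Ω] in
/-- The same in `ℝ≥0∞`. -/
theorem ofReal_exp_neg_mul_involAcceptE (H : Ω → ℝ) (Φ : Ω → Ω) (x : Ω) :
    ENNReal.ofReal (Real.exp (-H x)) * involAcceptE H Φ x =
      ENNReal.ofReal (min (Real.exp (-H x)) (Real.exp (-H (Φ x)))) := by
  rw [involAcceptE, ← ENNReal.ofReal_mul (Real.exp_pos _).le, exp_neg_mul_involAccept]

omit [MeasurableSpace Ω] in
/-- For an involution the symmetrised weight `min{e^{−H x}, e^{−H Φx}}` is `Φ`-invariant. -/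
theorem min_exp_neg_involutive {H : Ω → ℝ} {Φ : Ω → Ω} (hΦ : Function.Involutive Φ) (x : Ω) :
    min (Real.exp (-H (Φ x))) (Real.exp (-H (Φ (Φ x)))) =
      min (Real.exp (-H x)) (Real.exp (-H (Φ x))) := by
  rw [hΦ x, min_comm]

/-! ## The kernel -/

/-- **Metropolis kernel with a deterministic proposal.**  From `x`: propose `Φ x`, accept with
probability `min {1, e^{H x − H (Φ x)}}`, otherwise stay:
`K(x, ·) = a(x) δ_{Φ x} + (1 − a(x)) δ_x`. -/
noncomputable def involMH (Φ : Ω → Ω) (hΦ : Measurable Φ) (H : Ω → ℝ) : Kernel Ω Ω :=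
  Kernel.withDensity (Kernel.deterministic Φ hΦ) (fun x _ => involAcceptE H Φ x) +
    Kernel.withDensity (Kernel.deterministic id measurable_id) (fun x _ => 1 - involAcceptE H Φ x)

variable {Φ : Ω → Ω} {hΦ : Measurable Φ} {H : Ω → ℝ}

/-- Set-wise formula: `K(x, B) = a(x) 1_B(Φ x) + (1 − a(x)) 1_B(x)`. -/
theorem involMH_apply (hH : Measurable H) (x : Ω) {B : Set Ω} (hB : MeasurableSet B) :
    involMH Φ hΦ H x B =
      involAcceptE H Φ x * B.indicator 1 (Φ x) + (1 - involAcceptE H Φ x) * B.indicator 1 x := by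
  have h1 : Measurable (Function.uncurry fun (x : Ω) (_ : Ω) => involAcceptE H Φ x) :=
    (measurable_involAcceptE hH hΦ).comp measurable_fst
  have h2 : Measurable (Function.uncurry fun (x : Ω) (_ : Ω) => 1 - involAcceptE H Φ x) :=
    measurable_const.sub ((measurable_involAcceptE hH hΦ).comp measurable_fst)
  rw [involMH, Kernel.add_apply, Measure.add_apply, Kernel.withDensity_apply' _ h1,
    Kernel.withDensity_apply' _ h2, Kernel.deterministic_apply, Kernel.deterministic_apply,
    setLIntegral_const, setLIntegral_const, id, Measure.dirac_apply' _ hB,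
    Measure.dirac_apply' _ hB]

/-- The deterministic-proposal Metropolis kernel is a Markov kernel. -/
instance instIsMarkovKernelInvolMH [Fact (Measurable H)] : IsMarkovKernel (involMH Φ hΦ H) := by
  refine ⟨fun x => ⟨?_⟩⟩
  rw [involMH_apply (Fact.out) x MeasurableSet.univ, Set.indicator_univ, Pi.one_apply,
    Pi.one_apply, mul_one, mul_one]
  exact add_tsub_cancel_of_le (involAcceptE_le_one H Φ x)

/-! ## Reversibility for volume-preserving involutions -/

/-- The mass flow `∫_A K(x, B) e^{−H} dvol`, split into the move part (an integral of the
symmetrised weight over `A ∩ Φ⁻¹ B`) and the diagonal rejection part over `A ∩ B`. -/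
theorem setLIntegral_involMH {vol : Measure Ω} (hH : Measurable H) {A B : Set Ω}
    (hA : MeasurableSet A) (hB : MeasurableSet B) :
    ∫⁻ x in A, involMH Φ hΦ H x B ∂(vol.withDensity fun x => ENNReal.ofReal (Real.exp (-H x))) =
      (∫⁻ x in Φ ⁻¹' B ∩ A,
          ENNReal.ofReal (min (Real.exp (-H x)) (Real.exp (-H (Φ x)))) ∂vol) +
        ∫⁻ x in B ∩ A, ENNReal.ofReal (Real.exp (-H x)) * (1 - involAcceptE H Φ x) ∂vol := by
  have hd : Measurable fun x => ENNReal.ofReal (Real.exp (-H x)) :=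
    (Real.measurable_exp.comp hH.neg).ennreal_ofReal
  have ha : Measurable (involAcceptE H Φ) := measurable_involAcceptE hH hΦ
  have hK : Measurable fun x => involMH Φ hΦ H x B := Kernel.measurable_coe _ hB
  rw [setLIntegral_withDensity_eq_setLIntegral_mul _ hd hK hA]
  simp only [Pi.mul_apply]
  have hpt : ∀ x, ENNReal.ofReal (Real.exp (-H x)) * involMH Φ hΦ H x B =
      (Φ ⁻¹' B).indicator
          (fun x => ENNReal.ofReal (min (Real.exp (-H x)) (Real.exp (-H (Φ x))))) x +
        B.indicator (fun x => ENNReal.ofReal (Real.exp (-H x)) * (1 - involAcceptE H Φ x)) x := by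
    intro x
    rw [involMH_apply hH x hB, mul_add, ← mul_assoc, ofReal_exp_neg_mul_involAcceptE]
    congr 1
    · by_cases hx : Φ x ∈ B
      · rw [Set.indicator_of_mem hx, Set.indicator_of_mem (show x ∈ Φ ⁻¹' B from hx),
          Pi.one_apply, mul_one]
      · rw [Set.indicator_of_notMem hx, Set.indicator_of_notMem (show x ∉ Φ ⁻¹' B from hx),
          mul_zero]
    · by_cases hx : x ∈ B
      · rw [Set.indicator_of_mem hx, Set.indicator_of_mem hx, Pi.one_apply, mul_one]
      · rw [Set.indicator_of_notMem hx, Set.indicator_of_notMem hx, mul_zero, mul_zero]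
  simp_rw [hpt]
  have hind : Measurable
      (B.indicator fun x => ENNReal.ofReal (Real.exp (-H x)) * (1 - involAcceptE H Φ x)) :=
    (hd.mul (measurable_const.sub ha)).indicator hB
  rw [lintegral_add_right _ hind, lintegral_indicator hB, Measure.restrict_restrict hB,
    lintegral_indicator (hΦ hB), Measure.restrict_restrict (hΦ hB)]

/-- **L7 / HMC skeleton — volume-preserving involutions give exact Metropolis kernels.**  If
`Φ` is an involution preserving `vol`, then `involMH Φ hΦ H` is reversible with respect to
`e^{−H} · vol` (Mathlib's `Kernel.IsReversible`), for EVERY measurable `H`. -/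
theorem involMH_isReversible {vol : Measure Ω} (hH : Measurable H) (hinv : Function.Involutive Φ)
    (hvol : MeasurePreserving Φ vol vol) :
    Kernel.IsReversible (involMH Φ hΦ H)
      (vol.withDensity fun x => ENNReal.ofReal (Real.exp (-H x))) := by
  intro A B hA hB
  rw [setLIntegral_involMH hH hA hB, setLIntegral_involMH hH hB hA, Set.inter_comm B A]
  congr 1
  have hm : Measurable fun x => ENNReal.ofReal (min (Real.exp (-H x)) (Real.exp (-H (Φ x)))) :=
    ((Real.measurable_exp.comp hH.neg).min (Real.measurable_exp.comp (hH.comp hΦ).neg)).ennreal_ofReal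
  have hpre : Φ ⁻¹' (Φ ⁻¹' A ∩ B) = Φ ⁻¹' B ∩ A := by
    ext x
    simp only [Set.mem_preimage, Set.mem_inter_iff, hinv x]
    exact and_comm
  rw [← hvol.setLIntegral_comp_preimage ((hΦ hA).inter hB) hm, hpre]
  refine setLIntegral_congr_fun ((hΦ hB).inter hA) (fun x _ => ?_)
  rw [min_exp_neg_involutive hinv]

/-- **Exactness**: `e^{−H} vol` is invariant under the deterministic-proposal Metropolis kernel of
a `vol`-preserving involution (HMC: Liouville measure, leapfrog ∘ momentum flip). -/
theorem involMH_invariant {vol : Measure Ω} (hH : Measurable H) (hinv : Function.Involutive Φ)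
    (hvol : MeasurePreserving Φ vol vol) :
    Kernel.Invariant (involMH Φ hΦ H) (vol.withDensity fun x => ENNReal.ofReal (Real.exp (-H x))) := by
  haveI : Fact (Measurable H) := ⟨hH⟩
  exact (involMH_isReversible hH hinv hvol).invariant

/-! ## E5: the T-REX replica-exchange swap through a volume-preserving bijection -/

section TREX

variable (f : Ω ≃ᵐ Ω)

/-- The T-REX swap move on the product of two replicas: `(x, y) ↦ (f⁻¹ y, f x)`. -/
def trexSwap (z : Ω × Ω) : Ω × Ω := (f.symm z.2, f z.1)

/-- The swap move is measurable. -/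
theorem measurable_trexSwap : Measurable (trexSwap f) :=
  (f.symm.measurable.comp measurable_snd).prodMk (f.measurable.comp measurable_fst)

/-- The swap move is an involution. -/
theorem trexSwap_involutive : Function.Involutive (trexSwap f) := by
  intro z
  simp only [trexSwap, MeasurableEquiv.symm_apply_apply, MeasurableEquiv.apply_symm_apply]

/-- The swap move preserves `vol ⊗ vol` when `f` preserves `vol`. -/
theorem measurePreserving_trexSwap {vol : Measure Ω} [SFinite vol]
    (hf : MeasurePreserving f vol vol) :
    MeasurePreserving (trexSwap f) (vol.prod vol) (vol.prod vol) := by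
  have h : trexSwap f = Prod.map f.symm f ∘ Prod.swap := by
    funext z; rfl
  rw [h]
  exact ((hf.symm f).prod hf).comp Measure.measurePreserving_swap

/-- **E5 — the T-REX swap is exact.**  For two replicas with actions `S₁`, `S₂` (target
`e^{−S₁(x) − S₂(y)} vol ⊗ vol`) and ANY `vol`-preserving measurable bijection `f`, the move
`(x, y) ↦ (f⁻¹ y, f x)` accepted with `min {1, exp (S₁ x + S₂ y − S₁ (f⁻¹ y) − S₂ (f x))}` is
reversible — replica exchange through a trained volume-preserving flow keeps detailed balance
however good the flow is. -/
theorem trex_isReversible {vol : Measure Ω} [SFinite vol] {S₁ S₂ : Ω → ℝ} (hS₁ : Measurable S₁)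
    (hS₂ : Measurable S₂) (hf : MeasurePreserving f vol vol) :
    Kernel.IsReversible
      (involMH (trexSwap f) (measurable_trexSwap f) fun z => S₁ z.1 + S₂ z.2)
      ((vol.prod vol).withDensity fun z => ENNReal.ofReal (Real.exp (-(S₁ z.1 + S₂ z.2)))) :=
  involMH_isReversible ((hS₁.comp measurable_fst).add (hS₂.comp measurable_snd))
    (trexSwap_involutive f) (measurePreserving_trexSwap f hf)

end TREX

end Summit.Ventures.LatticeQCDFlow.Exactness
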